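/-
Copyright (c) 2026 the pub-hodgecm-mathlib formalisation cell (harness21).  Prover seat hodgecm-mathlib-K2-defs1 (g6), Track B, h413 = `stmt-HodgeConjecture-24833`, route `HCCMUnconditional`,
deal (270) of dealer K2E1-plan (g7) (G4): the PER-POINT truncated families beyond M1 — the level twin of ★ K2E1-p15 `K2E1ChiEisensteinPerPointFamilyM1CMTwo` (p860705).
-/
import Summits.HodgeConjecture.HodgeConjecture.Theorems.K2E1ChiEisensteinFamilyExportLevelCMTwo   -- 📤 (this seat): `chiEisenstein_family_export_level_cm_two'` (general level)
import Summits.HodgeConjecture.HodgeConjecture.Theorems.K2E1ChiEisensteinPerPointFamilyCMTwo     -- ★ p860657∕ED.2 (this seat): `exists_perPoint_truncatedFamily'`, `countable_bad`, `exists_good_ball`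
import Summits.HodgeConjecture.HodgeConjecture.Theorems.K2E1ChiEisensteinConstantTermCMTwo     -- ★ p859580 (this seat): `borelConstantTerm_chiEisenstein_cm_two`
import Summits.HodgeConjecture.HodgeConjecture.Theorems.K2E1ChiMaassSelbergCMTwo               -- ★ (K2E1-p14): `IsChiSection.arithmeticBorel_mul`
import Summits.HodgeConjecture.HodgeConjecture.Theorems.K2E1SphericalHeckeEigenSectionU2       -- ★ (K2E1-p11): `continuous_borelHeight_cpow`, `norm_borelHeight_cpow`, `borelHeight_coe_pos`
import HarnessLib

/-!
# `K2E1ChiEisensteinPerPointFamilyLevelCMTwo` — THE LEVEL TWIN of ★ `chiEisenstein_perPoint_family_maximalLevel_cm_two` (K2E1-p15 p860705): for `φ ∈ V(χ, K′, ω)` at a general level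
# `K′` (every `(χ_∞, ω)`), the exports `q, Ec, qc, P`, (E1)–(E4), AND the per-point truncated `L²`-families off a countable bad set `S ⊇ P` — ★'s statement and proof VERBATIM with
# `V(χ, K, 1)`, `φ ∘ ι = φ(1)` replaced by `V(χ, K′, ω)` and the structural level binders, and ★ p860640's M1 family export by 📤 `chiEisenstein_family_export_level_cm_two'`

Cell `pub/hodgecm-mathlib`, crux H413 = `stmt-HodgeConjecture-24833`.  THEOREMS ONLY (no `def`, no `instance`, no notation, no named-fact hypothesis, no `sorry`); lane `--supports
stmt-HodgeConjecture-24833 --as helper` (count-neutral).  Closes no socket.  The M1 tokens of ★ p860705 were exactly the call of the M1 family export (binder `hφinf`) and the syntactic type of the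
basis `bV`; everything else (★ p860657 `exists_perPoint_truncatedFamily'`, ★ `borelConstantTerm_chiEisenstein_cm_two`, ★ `IsChiSection.arithmeticBorel_mul`, the countable bad set) is
level-generic and reused unchanged. [BernsteinLapid2019, Thm 2.3, §4, §7; MoeglinWaldspurger1995, II.1.7, IV.1.8–IV.1.11, IV.2.3]
* HEAD **`chiEisenstein_perPoint_family_level_cm_two`**.
HONEST LABEL: HC_CM is proved only modulo the 7 printed citations (2 remaining named inputs: hLiu418 = `stmt-HodgeConjecture-24832`, h413 = `stmt-HodgeConjecture-24833`) until rung 0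
closes; count-neutral helper, closes no socket.

## References
* [BernsteinLapid2019] J. Bernstein, E. Lapid, *On the meromorphic continuation of Eisenstein series*, J. AMS 37 (2024), Thm 2.3, §4, §7.
* [MoeglinWaldspurger1995] C. Mœglin, J.-L. Waldspurger, *Spectral Decomposition and Eisenstein Series* (1995), II.1.7, IV.1.8–IV.1.11, IV.2.3.
-/

set_option autoImplicit false
set_option linter.dupNamespace false  -- the mandated namespace repeats the summit's segment (`HodgeConjecture.HodgeConjecture`)

noncomputable section

open MeasureTheory Measure Filter Topology Set NumberField IsDedekindDomain Metric
open scoped NNReal ENNReal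
open Literature.MeasureTheory.Group Literature.NumberTheory Literature.NumberTheory.Automorphic Literature.NumberTheory.Automorphic.UnitaryGroup AdelicGroupData
open Literature.NumberTheory.GaloisRepresentations (HeckeCharacter)
open Summit.HodgeConjecture.HodgeConjecture.Cruxes.H413.K2E1BorelEisensteinU
open Summit.HodgeConjecture.HodgeConjecture.Cruxes.H413.K2E1BLBorelSpacesU2Defs
open Summit.HodgeConjecture.HodgeConjecture.Cruxes.H413.K2E1BLBorelOperatorsU2Defs
open Summit.HodgeConjecture.HodgeConjecture.Cruxes.H413.K2E1CharacterEisensteinU2Defs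
open Summit.HodgeConjecture.HodgeConjecture.Cruxes.H413.K2E1ChiSectionSpaceU2Defs
open Summit.HodgeConjecture.HodgeConjecture.Cruxes.H413.K2E1ChiEisensteinFamilyExportLevelCMTwo (chiEisenstein_family_export_level_cm_two')
open Summit.HodgeConjecture.HodgeConjecture.Cruxes.H413.K2E1ChiEisensteinPerPointFamilyCMTwo (exists_perPoint_truncatedFamily' countable_bad exists_good_ball)
open Summit.HodgeConjecture.HodgeConjecture.Cruxes.H413.K2E1ChiEisensteinConstantTermCMTwo (borelConstantTerm_chiEisenstein_cm_two)
open Summit.HodgeConjecture.HodgeConjecture.Cruxes.H413.K2E1SphericalHeckeEigenSectionU2 (continuous_borelHeight_cpow norm_borelHeight_cpow borelHeight_coe_pos)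

namespace Summit.HodgeConjecture.HodgeConjecture.Cruxes.H413.K2E1ChiEisensteinPerPointFamilyLevelCMTwo

variable (L : Type) [Field L] [NumberField L] [IsCMField L]
  [MeasurableSpace (quasiSplit (↥(maximalRealSubfield L)) L (IsCMField.complexConj L) 2).Adelic] [BorelSpace (quasiSplit (↥(maximalRealSubfield L)) L (IsCMField.complexConj L) 2).Adelic]
  [MeasurableSpace (arch (↥(maximalRealSubfield L)) L (IsCMField.complexConj L) 2 ((StdForm.antidiagonal 2).over L))] [BorelSpace (arch (↥(maximalRealSubfield L)) L (IsCMField.complexConj L) 2 ((StdForm.antidiagonal 2).over L))]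
  [MeasurableSpace (finAdelic (↥(maximalRealSubfield L)) L (IsCMField.complexConj L) 2 ((StdForm.antidiagonal 2).over L))] [BorelSpace (finAdelic (↥(maximalRealSubfield L)) L (IsCMField.complexConj L) 2 ((StdForm.antidiagonal 2).over L))]

/-- **THE LETTER-FREE PER-POINT CONTINUED TRUNCATED FAMILY AT M1** (module docstring). [cite: MoeglinWaldspurger1995, II.1.7, IV.2.3] [cite: BernsteinLapid2019, Thm 2.3, §4, §7] -/
theorem chiEisenstein_perPoint_family_level_cm_two
    (μ : Measure (quasiSplit (↥(maximalRealSubfield L)) L (IsCMField.complexConj L) 2).automorphicQuotient) [(quasiSplit (↥(maximalRealSubfield L)) L (IsCMField.complexConj L) 2).IsAutomorphicMeasure μ]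
    (νG : Measure (quasiSplit (↥(maximalRealSubfield L)) L (IsCMField.complexConj L) 2).Adelic) [νG.IsHaarMeasure] [νG.IsInvInvariant] [SFinite νG]
    (ν : Measure ↥(adelicUnipotent (↥(maximalRealSubfield L)) L (IsCMField.complexConj L) 2)) [ν.IsHaarMeasure] [ν.IsMulRightInvariant] [ν.IsInvInvariant]
    {𝓕 : Set ↥(adelicUnipotent (↥(maximalRealSubfield L)) L (IsCMField.complexConj L) 2)}
    (h𝓕N : IsFundamentalDomain ↥(rationalUnipotent (↥(maximalRealSubfield L)) L (IsCMField.complexConj L) 2) 𝓕 ν) (h𝓕c : IsCompact (closure 𝓕)) (h𝓕₀ : ν 𝓕 ≠ 0)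
    {β : (quasiSplit (↥(maximalRealSubfield L)) L (IsCMField.complexConj L) 2).Adelic → ℝ≥0∞}
    (hβ : IsCoveringWeight ↥((arithmeticBorel (↥(maximalRealSubfield L)) L (IsCMField.complexConj L) 2).map (quasiSplit (↥(maximalRealSubfield L)) L (IsCMField.complexConj L) 2).arithmeticSubgroup.subtype) β)
    {μZ : Measure (borelQuotient (↥(maximalRealSubfield L)) L (IsCMField.complexConj L) 2)} [SFinite μZ]
    (hμZ : ∀ f : borelQuotient (↥(maximalRealSubfield L)) L (IsCMField.complexConj L) 2 → ℝ≥0∞, Measurable f → ∫⁻ z, f z ∂μZ = ∫⁻ g, β g * f (toBorelQuotient (↥(maximalRealSubfield L)) L (IsCMField.complexConj L) 2 g) ∂νG)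
    -- the M1 family: `φ ∈ V(χ, K, 1)` continuous bounded with `φ ∘ ι_∞ = φ(1)`, and a basis of `V(χʷ, K, 1)` by continuous bounded functions
    {χ : HeckeCharacter L} {K' : Subgroup (quasiSplit (↥(maximalRealSubfield L)) L (IsCMField.complexConj L) 2).Adelic} {ω : ↥K' → ℂ} {φ : (quasiSplit (↥(maximalRealSubfield L)) L (IsCMField.complexConj L) 2).Adelic → ℂ} (hφV : φ ∈ chiSectionSpace χ K' ω) (hφc : Continuous φ) {Mφ : ℝ} (hφM : ∀ x, ‖φ x‖ ≤ Mφ)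
    -- the LEVEL: `K′ ≤ K`, `ι(K_∞) ⊆ K′`, an open compact `U₀` with `ι_f(U₀ ∩ G_f) ⊆ K′` on which `ω = 1`, continuity of the sections; auxiliary Haar measures on `G_∞` (two-sided) and `G(𝔸_f)`
    (hK' : K' ≤ ((standardMaximalCompactGL 2 L).comap (adelicVal (↥(maximalRealSubfield L)) L (IsCMField.complexConj L) 2 ((StdForm.antidiagonal 2).over L)) : Subgroup (quasiSplit (↥(maximalRealSubfield L)) L (IsCMField.complexConj L) 2).Adelic))
    (hKinf : ∀ k : arch (↥(maximalRealSubfield L)) L (IsCMField.complexConj L) 2 ((StdForm.antidiagonal 2).over L), adelicVal (↥(maximalRealSubfield L)) L (IsCMField.complexConj L) 2 ((StdForm.antidiagonal 2).over L) (archToAdelic (↥(maximalRealSubfield L)) L (IsCMField.complexConj L) 2 _ k) ∈ standardMaximalCompactGL 2 L →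
      archToAdelic (↥(maximalRealSubfield L)) L (IsCMField.complexConj L) 2 _ k ∈ K')
    (U₀ : Subgroup (GL (Fin 2) (FiniteAdeleRing (𝓞 L) L))) (hU₀o : IsOpen (U₀ : Set (GL (Fin 2) (FiniteAdeleRing (𝓞 L) L)))) (hU₀c : IsCompact (U₀ : Set (GL (Fin 2) (FiniteAdeleRing (𝓞 L) L))))
    (hU : ∀ b : finAdelic (↥(maximalRealSubfield L)) L (IsCMField.complexConj L) 2 ((StdForm.antidiagonal 2).over L), (b : GL (Fin 2) (FiniteAdeleRing (𝓞 L) L)) ∈ U₀ →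
      ∃ hb : finAdelicToAdelic (↥(maximalRealSubfield L)) L (IsCMField.complexConj L) 2 ((StdForm.antidiagonal 2).over L) b ∈ K', ω ⟨_, hb⟩ = 1)
    (hVc : ∀ φ ∈ chiSectionSpace χ K' ω, Continuous φ)
    (μa : Measure (arch (↥(maximalRealSubfield L)) L (IsCMField.complexConj L) 2 ((StdForm.antidiagonal 2).over L))) [μa.IsHaarMeasure] [μa.IsMulRightInvariant]
    (μf : Measure (finAdelic (↥(maximalRealSubfield L)) L (IsCMField.complexConj L) 2 ((StdForm.antidiagonal 2).over L))) [μf.IsHaarMeasure]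
    {ι' : Type} [Fintype ι'] [DecidableEq ι'] (bV : Module.Basis ι' ℂ ↥(chiSectionSpace (reflectChar (IsCMField.complexConj L) χ) K' ω))
    (hbc : ∀ j, Continuous ((bV j : ↥(chiSectionSpace (reflectChar (IsCMField.complexConj L) χ) K' ω)) : (quasiSplit (↥(maximalRealSubfield L)) L (IsCMField.complexConj L) 2).Adelic → ℂ)) {Mb : ℝ} (hbM : ∀ j x, ‖((bV j : ↥(chiSectionSpace (reflectChar (IsCMField.complexConj L) χ) K' ω)) : (quasiSplit (↥(maximalRealSubfield L)) L (IsCMField.complexConj L) 2).Adelic → ℂ) x‖ ≤ Mb) :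
    ∃ (q : ι' → ℂ → ℂ) (Ec : ℂ → (quasiSplit (↥(maximalRealSubfield L)) L (IsCMField.complexConj L) 2).Adelic → ℂ) (qc : ι' → ℂ → ℂ) (P : Set ℂ),
      (∀ j, DifferentiableOn ℂ (q j) {z : ℂ | 1 < z.re}) ∧
      (∀ z : ℂ, 1 < z.re → (∑ j, q j z • ((bV j : ↥(chiSectionSpace (reflectChar (IsCMField.complexConj L) χ) K' ω)) : (quasiSplit (↥(maximalRealSubfield L)) L (IsCMField.complexConj L) 2).Adelic → ℂ)) = ((((ν 𝓕).toReal⁻¹ : ℝ)) : ℂ) • (fun g : (quasiSplit (↥(maximalRealSubfield L)) L (IsCMField.complexConj L) 2).Adelic => (∫ v : ↥(adelicUnipotent (↥(maximalRealSubfield L)) L (IsCMField.complexConj L) 2), flatSectionU φ z ((quasiSplit (↥(maximalRealSubfield L)) L (IsCMField.complexConj L) 2).toAdelic (weylLongU ((IsCMField.complexConj L : L ≃ₐ[↥(maximalRealSubfield L)] L) : L →+* L) (rfl : (StdForm.antidiagonal 2).over L = (StdForm.antidiagonal 2).over L)) * ((v : (quasiSplit (↥(maximalRealSubfield L)) L (IsCMField.complexConj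 L) 2).Adelic) * g)) ∂ν) * (((borelHeight g : ℝ) : ℂ) ^ (z - 1)))) ∧
      (∀ g, MeromorphicNFOn (fun z => Ec z g) univ) ∧ (∀ j, MeromorphicNFOn (qc j) univ) ∧
      (∀ z : ℂ, 1 < z.re → Ec z = eisensteinSeriesU (flatSectionU φ z)) ∧ (∀ j (z : ℂ), 1 < z.re → qc j z = q j z) ∧
      IsClosed P ∧ (∀ z₀ : ℂ, ∀ᶠ s in 𝓝[≠] z₀, s ∉ P) ∧ (∀ z ∈ P, z.re ≤ 1) ∧
      (∀ g (z : ℂ), z ∉ P → AnalyticAt ℂ (fun z => Ec z g) z) ∧ (∀ j (z : ℂ), z ∉ P → AnalyticAt ℂ (qc j) z) ∧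
      (∀ g, DifferentiableOn ℂ (fun z => Ec z g) Pᶜ) ∧ (∀ j, DifferentiableOn ℂ (qc j) Pᶜ) ∧
      (∀ z : ℂ, z ∉ P → Continuous (Ec z)) ∧
      ∃ S : Set ℂ, S.Countable ∧ P ⊆ S ∧
        ∀ T : ℝ≥0, 1 ≤ T → ∀ z : ℂ, 1 / 2 < z.re → z.im ≠ 0 → z ∉ S →
          ∃ (D₁ O₁ O₂' : Set ℂ) (Fam' : ℂ → Lp ℂ 2 μ), IsOpen D₁ ∧ IsPreconnected D₁ ∧
            (D₁ ⊆ {z : ℂ | 1 / 2 < z.re ∧ 0 < z.im} ∨ D₁ ⊆ {z : ℂ | 1 / 2 < z.re ∧ z.im < 0}) ∧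
            IsOpen O₁ ∧ O₁.Nonempty ∧ O₁ ⊆ D₁ ∧ IsOpen O₂' ∧ O₂'.Nonempty ∧ O₂' ⊆ D₁ ∧ (∀ w ∈ O₁, ∀ w' ∈ O₂', 1 < w'.re ∧ w'.re < w.re) ∧ z ∈ D₁ ∧ D₁ ⊆ Pᶜ ∧
            DifferentiableOn ℂ Fam' D₁ ∧
            ∀ w' ∈ D₁, 1 < w'.re → ((Fam' w' : Lp ℂ 2 μ) : (quasiSplit (↥(maximalRealSubfield L)) L (IsCMField.complexConj L) 2).automorphicQuotient → ℂ) =ᵐ[μ]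
              (quasiSplit (↥(maximalRealSubfield L)) L (IsCMField.complexConj L) 2).quotFun (truncation ν 𝓕 T (Ec w')) := by
  classical
  obtain ⟨q, Ec, qc, P, hq, hqφ, h1, h2, hE1, hqcq, hPc, hPcd, hPre, hEan, hqan, hEdiff, hqdiff, hEcont, hF⟩ :=
    chiEisenstein_family_export_level_cm_two' L μ νG ν h𝓕N h𝓕c h𝓕₀ hβ hμZ hφV hφc hφM hK' hKinf U₀ hU₀o hU₀c hU hVc μa μf bV hbc hbM
  -- skolemise the per-ball export
  choose U T₀ Fam hUo hUD hUcd hT₀ hFd hFt using fun n : ℕ => hF n (Nat.zero_le n)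
  have hPcount : P.Countable := by
    -- `P` is co-discrete, hence countable in every ball, hence countable
    have h : P ⊆ ⋃ n : ℕ, (Metric.ball (0 : ℂ) (n + 2) ∩ P) := fun z hz => by
      refine Set.mem_iUnion.2 ⟨⌈‖z‖⌉₊, ?_, hz⟩
      rw [mem_ball_zero_iff]
      have := Nat.le_ceil ‖z‖
      linarith
    refine (Set.countable_iUnion fun n => ?_).mono h
    have hcd : ∀ z₀ ∈ Metric.ball (0 : ℂ) ((n : ℝ) + 2), ∀ᶠ s in 𝓝[≠] z₀, s ∈ Pᶜ := fun z₀ _ => hPcd z₀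
    have := K2E1SphericalEisensteinPoleExclusionCMThree.countable_ball_diff_of_codiscrete hcd
    refine this.mono ?_
    intro z hz
    exact ⟨hz.1, fun h => h hz.2⟩
  -- the band datum
  set w : ℂ → (quasiSplit (↥(maximalRealSubfield L)) L (IsCMField.complexConj L) 2).Adelic → ℂ :=
    fun z => flatSectionU φ z + flatSectionU (∑ j, qc j z • ((bV j : ↥(chiSectionSpace (reflectChar (IsCMField.complexConj L) χ) K' ω)) : (quasiSplit (↥(maximalRealSubfield L)) L (IsCMField.complexConj L) 2).Adelic → ℂ)) (1 - z) with hw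
  have hw_apply : ∀ z g, w z g = φ g * (((borelHeight g : ℝ≥0) : ℝ) : ℂ) ^ z + (∑ j, qc j z * ((bV j : ↥(chiSectionSpace (reflectChar (IsCMField.complexConj L) χ) K' ω)) : (quasiSplit (↥(maximalRealSubfield L)) L (IsCMField.complexConj L) 2).Adelic → ℂ) g) * (((borelHeight g : ℝ≥0) : ℝ) : ℂ) ^ (1 - z) := fun z g => by
    simp only [hw, Pi.add_apply, flatSectionU_apply, Finset.sum_apply, Pi.smul_apply, smul_eq_mul]
  have hφχ : IsChiSection χ φ := hφV.1
  have hbχ : ∀ j, IsChiSection (reflectChar (IsCMField.complexConj L) χ) ((bV j : ↥(chiSectionSpace (reflectChar (IsCMField.complexConj L) χ) K' ω)) : (quasiSplit (↥(maximalRealSubfield L)) L (IsCMField.complexConj L) 2).Adelic → ℂ) := fun j => (bV j).2.1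
  -- (B(F)) invariance
  have hwB : ∀ z : ℂ, z ∉ P → ∀ β' ∈ arithmeticBorel (↥(maximalRealSubfield L)) L (IsCMField.complexConj L) 2, ∀ g,
      w z ((β' : (quasiSplit (↥(maximalRealSubfield L)) L (IsCMField.complexConj L) 2).Adelic) * g) = w z g := by
    intro z _ β' hβ' g
    rw [hw_apply, hw_apply, hφχ.arithmeticBorel_mul β' hβ' g, K2E1TruncatedEisensteinExplicit.borelHeight_arithmeticBorel_mul hβ']
    congr 2
    exact Finset.sum_congr rfl fun j _ => by rw [(hbχ j).arithmeticBorel_mul β' hβ' g]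
  -- continuity
  have hwc : ∀ z : ℂ, z ∉ P → Continuous (w z) := by
    intro z _
    have : w z = fun g => φ g * (((borelHeight g : ℝ≥0) : ℝ) : ℂ) ^ z + (∑ j, qc j z * ((bV j : ↥(chiSectionSpace (reflectChar (IsCMField.complexConj L) χ) K' ω)) : (quasiSplit (↥(maximalRealSubfield L)) L (IsCMField.complexConj L) 2).Adelic → ℂ) g) * (((borelHeight g : ℝ≥0) : ℝ) : ℂ) ^ (1 - z) := funext (hw_apply z)
    rw [this]
    exact (hφc.mul (continuous_borelHeight_cpow z)).add ((continuous_finsetSum _ fun j _ => continuous_const.mul (hbc j)).mul (continuous_borelHeight_cpow (1 - z)))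
  -- pointwise holomorphy off `P`
  have hwd : ∀ g, DifferentiableOn ℂ (fun z => w z g) Pᶜ := by
    intro g
    have hH : (((borelHeight g : ℝ≥0) : ℝ) : ℂ) ≠ 0 := Complex.ofReal_ne_zero.2 (ne_of_gt (borelHeight_coe_pos g))
    have : (fun z => w z g) = fun z => φ g * (((borelHeight g : ℝ≥0) : ℝ) : ℂ) ^ z + (∑ j, qc j z * ((bV j : ↥(chiSectionSpace (reflectChar (IsCMField.complexConj L) χ) K' ω)) : (quasiSplit (↥(maximalRealSubfield L)) L (IsCMField.complexConj L) 2).Adelic → ℂ) g) * (((borelHeight g : ℝ≥0) : ℝ) : ℂ) ^ (1 - z) := funext fun z => hw_apply z g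
    rw [this]
    refine DifferentiableOn.add ?_ ((DifferentiableOn.fun_sum fun j _ => (hqdiff j).mul_const _).mul ?_)
    · exact fun z _ => ((differentiableAt_id.const_cpow (Or.inl hH)).const_mul _).differentiableWithinAt
    · exact fun z _ => ((differentiableAt_id.const_sub (1 : ℂ)).const_cpow (Or.inl hH)).differentiableWithinAt
  -- local boundedness on bands above height 1
  have hwloc : ∀ z₀ : ℂ, z₀ ∉ P → ∀ lo hi : ℝ≥0, 1 ≤ lo → ∃ r > 0, Metric.ball z₀ r ⊆ Pᶜ ∧
      ∃ M : ℝ, ∀ z ∈ Metric.ball z₀ r, ∀ g, lo < borelHeight g → borelHeight g ≤ hi → ‖w z g‖ ≤ M := by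
    intro z₀ hz₀ lo hi hlo
    obtain ⟨r₀, hr₀, hr₀P⟩ := Metric.isOpen_iff.1 hPc.isOpen_compl z₀ hz₀
    set r : ℝ := r₀ / 2 with hr
    have hr0 : 0 < r := by rw [hr]; positivity
    have hcl : Metric.closedBall z₀ r ⊆ Pᶜ := (Metric.closedBall_subset_ball (by rw [hr]; linarith)).trans hr₀P
    -- bounds of the `qc j` on the closed disc
    have hQ : ∀ j, ∃ Q : ℝ, ∀ z ∈ Metric.closedBall z₀ r, ‖qc j z‖ ≤ Q := fun j =>
      (isCompact_closedBall z₀ r).exists_bound_of_continuousOn (((hqdiff j).mono hcl).continuousOn)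
    choose Q hQ using hQ
    set R : ℝ := |z₀.re| + r with hR
    refine ⟨r, hr0, (Metric.ball_subset_closedBall).trans hcl, Mφ * (hi : ℝ) ^ R + (∑ j, Q j * Mb) * (hi : ℝ) ^ (1 + R), fun z hz g h1 h2 => ?_⟩
    have hM0 : 0 ≤ Mφ := (norm_nonneg _).trans (hφM g)
    have hH1 : (1 : ℝ) ≤ ((borelHeight g : ℝ≥0) : ℝ) := by exact_mod_cast hlo.trans h1.le
    have hHhi : ((borelHeight g : ℝ≥0) : ℝ) ≤ hi := by exact_mod_cast h2
    have hhi1 : (1 : ℝ) ≤ hi := hH1.trans hHhi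
    have hzre : |z.re| ≤ R := by
      have h3 : |z.re - z₀.re| ≤ ‖z - z₀‖ := by simpa only [Complex.sub_re] using Complex.abs_re_le_norm (z - z₀)
      have h4 : ‖z - z₀‖ < r := by rwa [Metric.mem_ball, dist_eq_norm] at hz
      rw [hR]
      have := abs_sub_abs_le_abs_sub z.re z₀.re
      linarith
    have hpow : ‖(((borelHeight g : ℝ≥0) : ℝ) : ℂ) ^ z‖ ≤ (hi : ℝ) ^ R := by
      rw [norm_borelHeight_cpow]
      calc ((borelHeight g : ℝ≥0) : ℝ) ^ z.re ≤ ((borelHeight g : ℝ≥0) : ℝ) ^ |z.re| := Real.rpow_le_rpow_of_exponent_le hH1 (le_abs_self _)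
        _ ≤ (hi : ℝ) ^ |z.re| := Real.rpow_le_rpow (by positivity) hHhi (abs_nonneg _)
        _ ≤ (hi : ℝ) ^ R := Real.rpow_le_rpow_of_exponent_le hhi1 hzre
    have hpow' : ‖(((borelHeight g : ℝ≥0) : ℝ) : ℂ) ^ (1 - z)‖ ≤ (hi : ℝ) ^ (1 + R) := by
      rw [norm_borelHeight_cpow]
      have hre : (1 - z).re ≤ 1 + R := by rw [Complex.sub_re, Complex.one_re]; linarith [neg_abs_le z.re]
      calc ((borelHeight g : ℝ≥0) : ℝ) ^ (1 - z).re ≤ ((borelHeight g : ℝ≥0) : ℝ) ^ (1 + R) := Real.rpow_le_rpow_of_exponent_le hH1 hre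
        _ ≤ (hi : ℝ) ^ (1 + R) := Real.rpow_le_rpow (by positivity) hHhi (by positivity)
    have hzcl : z ∈ Metric.closedBall z₀ r := Metric.ball_subset_closedBall hz
    have hQ0 : ∀ j, 0 ≤ Q j := fun j => (norm_nonneg _).trans (hQ j z₀ (Metric.mem_closedBall_self hr0.le))
    rw [hw_apply]
    refine (norm_add_le _ _).trans (add_le_add ?_ ?_)
    · rw [norm_mul]
      exact mul_le_mul (hφM g) hpow (norm_nonneg _) hM0
    · rw [norm_mul]
      refine mul_le_mul ((norm_sum_le _ _).trans (Finset.sum_le_sum fun j _ => ?_)) hpow' (norm_nonneg _) (Finset.sum_nonneg fun j _ => mul_nonneg (hQ0 j) ((norm_nonneg _).trans (hbM j g)))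
      rw [norm_mul]
      exact mul_le_mul (hQ j z hzcl) (hbM j g) (norm_nonneg _) (hQ0 j)
  -- the tube constant term
  have hCT : ∀ z : ℂ, z ∉ P → 1 < z.re → ∀ g, borelConstantTerm ν 𝓕 (eisensteinSeriesU (flatSectionU φ z)) g = w z g := by
    intro z _ hz g
    have hH : (((borelHeight g : ℝ≥0) : ℝ) : ℂ) ≠ 0 := Complex.ofReal_ne_zero.2 (ne_of_gt (borelHeight_coe_pos g))
    rw [borelConstantTerm_chiEisenstein_cm_two L ν h𝓕N h𝓕c hφχ hφc hφM hz g, hw_apply, flatSectionU_apply]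
    congr 1
    have hsum := congrFun (hqφ z hz) g
    simp only [Finset.sum_apply, Pi.smul_apply, smul_eq_mul] at hsum
    rw [show (∑ j, qc j z * ((bV j : ↥(chiSectionSpace (reflectChar (IsCMField.complexConj L) χ) K' ω)) : (quasiSplit (↥(maximalRealSubfield L)) L (IsCMField.complexConj L) 2).Adelic → ℂ) g) = ∑ j, q j z * ((bV j : ↥(chiSectionSpace (reflectChar (IsCMField.complexConj L) χ) K' ω)) : (quasiSplit (↥(maximalRealSubfield L)) L (IsCMField.complexConj L) 2).Adelic → ℂ) g from Finset.sum_congr rfl fun j _ => by rw [hqcq j z hz], hsum, Complex.real_smul,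
      mul_assoc, mul_assoc, ← Complex.cpow_add _ _ hH, show z - 1 + (1 - z) = 0 by ring, Complex.cpow_zero, mul_one]
    congr 1
    refine integral_congr_ae (Filter.Eventually.of_forall fun v => ?_)
    simp only [mul_assoc]
  -- assemble
  refine ⟨q, Ec, qc, P, hq, hqφ, h1, h2, hE1, hqcq, hPc, hPcd, hPre, hEan, hqan, hEdiff, hqdiff, hEcont,
    P ∪ ⋃ n : {n : ℕ // 0 ≤ n}, (Metric.ball (0 : ℂ) ((n : ℕ) + 2) \ U n), countable_bad hPcount 0 U (fun n _ => hUcd n), Set.subset_union_left, ?_⟩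
  intro T hT z hz₁ hzim hzS
  obtain ⟨hzP, n, hn₀, hn2, hzn, hzU⟩ := exists_good_ball 0 U hzS
  exact exists_perPoint_truncatedFamily' L μ ν 𝓕 hT φ Ec hE1 hPc hPcount 0 U T₀ Fam (fun n _ => hUo n) (fun n _ => hUcd n) (fun n _ => hT₀ n)
    (fun n _ => hFd n) (fun n _ => hFt n) w hwB hwc hwd hwloc hCT hz₁ hzim hzP hn₀ hn2 hzn hzU

end Summit.HodgeConjecture.HodgeConjecture.Cruxes.H413.K2E1ChiEisensteinPerPointFamilyLevelCMTwo
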